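import Mathlib
import HarnessLib
import Summits.HubbardSuperconductivity.HubbardSuperconductivity.Theorems.KLProgrammeKLRegimeEngineV8DefsG8
import Summits.HubbardSuperconductivity.HubbardSuperconductivity.Theorems.KLProgrammeKLRegimeSplitGeoShellLog

/-!
# K3 ENGINE package, `G`-level v9 (token #15′; located risk #15 «(E2)-FRZ-LOG», pen g20 (R54s)/(R54w) (β′) GO-ELECT, g21 (R54ad) substitute filer
# p1b g13): `klEngGeo9 := klEngGeo8.addShellLog (2 ^ 52)` — the frozen-branch AMENDMENT of `klEngGeo8.phGain` by k3c1-p1's shell-log profile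

WHY.  The relative class-#5 bar (`klRelGain`, `transferBarRelAtW[F]`, `transferBarRelIdx`; p586507/p586991/p590284) and the plain (E2-F2)ₙ increment at frozen
transfers both carry the SHELL COUNT `kₙ(ρ) = #{j ≤ n : Λ_j ≤ ρ}`; `klEngGeo8.phGain`'s frozen branch `2^52·Λₙ/ρ` hosts it only up to a finite depth, while
`closes` quantifies `U → 0` with unbounded depth `n_β` — a formal hole for a stub text that must be TRUE as typed (pen (R54s)).  k3c1-p1's generic amendment
`GeoConsts.addShellLog G C` (`…KLRegimeSplitGeoShellLog`, p587359: `phGain′ n ρ = phGain n ρ + C·(klRelGain n (ρ ⊔ 0) + 2^{−n})`, `CF′ = CF + 7C`, every other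
field `rfl`; `addShellLog_wf`, `pred_le` kept, `Σₙ klRelGain n ρ ≤ 40/9`) removes it summability-preservingly; the FORMULA OF RECORD (R54w) fixes `C = 2^52`.

* `klEngGeo9`, `klEngGeo9_eq`, **`klEngGeo9_wf`**; the amended fields `klEngGeo9_phGain` / `klEngGeo9_CF` and the monotonicity every `≤ phGain`/`CF`-keyed consumer
  transfers by (`klEngGeo8_phGain_le_klEngGeo9_phGain`, `klEngGeo8_CF_le_klEngGeo9_CF`, `thermalBar_klEngGeo8_le_klEngGeo9`); `klEngGeo9_CF_nonneg`,
  `klIsoT_pow_four_le_klEngGeo9_CF` (class-#6 rows are stated under `0 ≤ CF` / `klIsoT⁴ ≤ CF`); the untouched fields by `rfl` (`cE4`, `ppGain`, `S`, `SL`, `Bf`,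
  `bhi`, `blo`, `aplus`, `ζ`, `Z`, `cloc`, `θ`, `a`, `atop`, `abot`) with the (E4) doors `klE4TF_le_klEngGeo9_cE4` / `klE4T6_le_…` / `klE4T_le_…`;
* HOSTING of the class-#5 relative bar at this package is NOT restated here: the step-3 hosting of record is p1 g13's SAME-PACKAGE form
  `transferBarRelIdx_le_transferBarAt_sameShellLog` / `pairTransferPinnedAt_compl_of_relIdx_sameShellLog` (`…PairTransferRelBarIdxHosting`, p592022) read at
  `G := klEngGeo8`, `C := 2^52` (= `klEngGeo9` by `rfl`); the `…_addShellLog` forms (p587359/p590284/p589147) host a `klEngGeo8`-keyed family into `klEngGeo9`.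
The v2 render of 20437 (rev 9 / 9-B) reads `klEngGeo9` at every former `klEngGeo8` site (names-only, V-all).  DefsU11 IMPORTS this module (pen (R54ad), AMENDMENT 11).
Definitions with bodies + order lemmas; nothing about the model is asserted; nothing asserts any stub of 20437, K3 or superconductivity.  0 kit · 0 lit.
-/

noncomputable section

namespace Summit.HubbardSuperconductivity.HubbardSuperconductivity.Theorems.EngineV8

set_option linter.dupNamespace false -- summit = problem name (single-conjunct summit), D-0017

open Real Finset Literature.MathematicalPhysics.QuantumLattice Literature.Probability.LatticeModels
open Summit.HubbardSuperconductivity.HubbardSuperconductivity.Theorems.KLRegimeSplit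
open Summit.HubbardSuperconductivity.HubbardSuperconductivity.Theorems.KLProgrammeLegKernels
open Summit.HubbardSuperconductivity.HubbardSuperconductivity.Theorems.DispersionFlow

/-! ## §1 The package and its well-formedness -/

/-- **`klEngGeo9`** — the engine-flow child's geometry package, v9 (token #15′): `klEngGeo8` with the particle–hole gain amended by the shell-log profile,
`klEngGeo8.addShellLog (2 ^ 52)` (formula of record, pen (R54w)). -/
def klEngGeo9 : GeoConsts := klEngGeo8.addShellLog (2 ^ 52)

/-- `klEngGeo9 = klEngGeo8.addShellLog (2 ^ 52)` (`rfl`). -/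
theorem klEngGeo9_eq : klEngGeo9 = klEngGeo8.addShellLog (2 ^ 52) := rfl

/-- **`klEngGeo9` is well formed** (`addShellLog_wf` on `klEngGeo8_wf`, `0 ≤ 2^52`). -/
theorem klEngGeo9_wf : klEngGeo9.WF := GeoConsts.addShellLog_wf klEngGeo8_wf (by norm_num)

/-! ## §2 The two amended fields and their monotonicity -/

/-- The amended particle–hole gain: `klEngGeo9.phGain n ρ = klEngGeo8.phGain n ρ + 2^52·(klRelGain n (ρ ⊔ 0) + 2^{−n})`. -/
theorem klEngGeo9_phGain (n : ℕ) (ρ : ℝ) :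
    klEngGeo9.phGain n ρ = klEngGeo8.phGain n ρ + 2 ^ 52 * (klRelGain n (max ρ 0) + ((2 : ℝ) ^ n)⁻¹) := rfl

/-- The amended freezing budget: `klEngGeo9.CF = klEngGeo8.CF + 7·2^52`. -/
theorem klEngGeo9_CF : klEngGeo9.CF = klEngGeo8.CF + 7 * 2 ^ 52 := rfl

/-- `klEngGeo8.phGain ≤ klEngGeo9.phGain` pointwise — every `≤ phGain`-keyed consumer of `klEngGeo8` transfers by name. -/
theorem klEngGeo8_phGain_le_klEngGeo9_phGain (n : ℕ) (ρ : ℝ) : klEngGeo8.phGain n ρ ≤ klEngGeo9.phGain n ρ :=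
  GeoConsts.phGain_le_addShellLog (G := klEngGeo8) (C := 2 ^ 52) (by norm_num) n ρ

/-- `klEngGeo8.CF ≤ klEngGeo9.CF` — every `CF`-keyed threshold/fit transfers by name (`IsIsoPkgB.mono_CF`, `exists_isoPkgB_addShellLog_of_momentLine`). -/
theorem klEngGeo8_CF_le_klEngGeo9_CF : klEngGeo8.CF ≤ klEngGeo9.CF :=
  GeoConsts.CF_le_addShellLog (G := klEngGeo8) (C := 2 ^ 52) (by norm_num)

/-- `klIsoT ^ 4 ≤ klEngGeo9.CF` (the class-#6 package rows are stated under it). -/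
theorem klIsoT_pow_four_le_klEngGeo9_CF : klIsoT ^ 4 ≤ klEngGeo9.CF := klIsoT_pow_four_le_klEngGeo8_CF.trans klEngGeo8_CF_le_klEngGeo9_CF

/-- `0 ≤ klEngGeo9.CF`. -/
theorem klEngGeo9_CF_nonneg : 0 ≤ klEngGeo9.CF := le_trans (by positivity) klIsoT_pow_four_le_klEngGeo9_CF

/-- The thermal bar only grows under the amendment: `thermalBar klEngGeo8 ≤ thermalBar klEngGeo9`. -/
theorem thermalBar_klEngGeo8_le_klEngGeo9 (P : SplitConsts) (U β : ℝ) (n : ℕ) : thermalBar klEngGeo8 P U β n ≤ thermalBar klEngGeo9 P U β n :=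
  thermalBar_le_addShellLog (G := klEngGeo8) (C := 2 ^ 52) (by norm_num) P U β n

/-! ## §3 The untouched fields (`rfl`) and the (E4) doors -/

/-- `cE4` is untouched by the amendment. -/
theorem klEngGeo9_cE4 : klEngGeo9.cE4 = klEngGeo8.cE4 := rfl
/-- `ppGain` is untouched. -/
theorem klEngGeo9_ppGain : klEngGeo9.ppGain = klEngGeo8.ppGain := rfl
/-- `S` is untouched. -/
theorem klEngGeo9_S : klEngGeo9.S = klEngGeo8.S := rfl
/-- `SL` is untouched. -/
theorem klEngGeo9_SL : klEngGeo9.SL = klEngGeo8.SL := rfl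
/-- `Bf` is untouched. -/
theorem klEngGeo9_Bf : klEngGeo9.Bf = klEngGeo8.Bf := rfl
/-- `bhi` is untouched. -/
theorem klEngGeo9_bhi : klEngGeo9.bhi = klEngGeo8.bhi := rfl
/-- `blo` is untouched. -/
theorem klEngGeo9_blo : klEngGeo9.blo = klEngGeo8.blo := rfl
/-- `aplus` is untouched. -/
theorem klEngGeo9_aplus : klEngGeo9.aplus = klEngGeo8.aplus := rfl
/-- `ζ` is untouched. -/
theorem klEngGeo9_ζ : klEngGeo9.ζ = klEngGeo8.ζ := rfl
/-- `Z` is untouched. -/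
theorem klEngGeo9_Z : klEngGeo9.Z = klEngGeo8.Z := rfl
/-- `cloc` is untouched. -/
theorem klEngGeo9_cloc : klEngGeo9.cloc = klEngGeo8.cloc := rfl
/-- `θ` is untouched. -/
theorem klEngGeo9_θ : klEngGeo9.θ = klEngGeo8.θ := rfl
/-- `a` is untouched. -/
theorem klEngGeo9_a : klEngGeo9.a = klEngGeo8.a := rfl
/-- `atop` is untouched. -/
theorem klEngGeo9_atop : klEngGeo9.atop = klEngGeo8.atop := rfl
/-- `abot` is untouched. -/
theorem klEngGeo9_abot : klEngGeo9.abot = klEngGeo8.abot := rfl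

/-- The flow-scale (E4) witness rides: `klE4TF ≤ klEngGeo9.cE4`. -/
theorem klE4TF_le_klEngGeo9_cE4 : klE4TF ≤ klEngGeo9.cE4 := klE4TF_le_klEngGeo8_cE4
/-- `klE4T6 ≤ klEngGeo9.cE4`. -/
theorem klE4T6_le_klEngGeo9_cE4 : klE4T6 ≤ klEngGeo9.cE4 := klE4T6_le_klEngGeo8_cE4
/-- `klE4T ≤ klEngGeo9.cE4`. -/
theorem klE4T_le_klEngGeo9_cE4 : klE4T ≤ klEngGeo9.cE4 := klE4T_le_klEngGeo8_cE4
/-- `klS6 j ≤ klEngGeo9.S j`. -/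
theorem klS6_le_klEngGeo9_S (j : ℕ) : klS6 j ≤ klEngGeo9.S j := klS6_le_klEngGeo8_S j

end Summit.HubbardSuperconductivity.HubbardSuperconductivity.Theorems.EngineV8

end
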